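import Literature.AlgebraicGeometry.ModuliOfAbelianVarieties.SiegelFamilyHumbertLemma
import Literature.AlgebraicGeometry.ModuliOfAbelianVarieties.SiegelFamilyHumbertSymmetricEndomorphism
import HarnessLib

/-!
# The general member of a Humbert surface: rigidity `H_{q₀} ⊆ H_q ⟺ q ∈ ℤq₀` and Picard number exactly `2`
# (Birkenhake–Wilhelm Prop. 4.9 (2), "for the general member of `H_Δ` equality holds")

[cite: BirkenhakeWilhelm2003, §4 Prop. 4.5 (p. 1828) and Prop. 4.9 (p. 1831)]
[cite: Runge1999EndomorphismRingsAbelianSurfaces, §4 pp. 290–291]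

Lane `lit-hodgefound`, Track 2, Layer A4 skeleton row A4-65, FILE 4 (a rider on FILE 1 `SiegelFamilyHumbertLemma`,
Humbert's lemma, and on row A4-59‴ `SiegelFamilyHumbertSymmetricEndomorphism`, the dimension formula
`dim_ℚ H²_Hodge(X_Z) = dim_ℚ W_Z + 1` with `W_Z ⊂ ℚ⁵` the space of rational singular relations of `Z`).

Birkenhake–Wilhelm, Prop. 4.9 (2) [BirkenhakeWilhelm2003, p. 1831]: "If `(X, L₀) ∈ H_Δ`, then `End^s(X) ⊗ ℚ`
contains the real quadratic number field `ℚ(√Δ)` and `ρ(X) ≥ 2`. For the general member of `H_Δ`, equality holds in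
both statements" — the proof of the last clause being "The last assertion is obvious."  Row A4-59‴ formalised the
inequality `ρ ≥ 2`; this file formalises the EQUALITY FOR THE GENERAL MEMBER, for the Picard number
`ρ(X_Z) := dim_ℚ H²_Hodge(X_Z)` (the tree's `Module.finrank ℚ (hodgeClasses (prinPeriod Z) 1)`; `= rk NS(X_Z)` by row
A4-11's Lefschetz (1,1)), with "general" in the Baire sense used throughout the lane (rows A4-56/A4-57: outside a
countable union of closed nowhere dense analytic subsets; dense, residual complement).

THE ARGUMENT (Runge's model + Humbert's lemma; elementary, no Dirichlet).  On Runge's standard model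
`π_{k,l} : ℍ × ℍ → 𝔥₂` of `H_{(k,l,−1,0,0)}` (row A4-64) a singular relation `q = (a,b,c,d,e)` restricts to the polynomial
`rel_q(π(τ)) = A₁τ₁ + A₂τ₂ − dΔ τ₁τ₂ + e`, `Aᵢ = a + bσᵢ + cσᵢ²` (§1 `singularRelation_modularEmbeddingMatrix`; because
`z₂² − z₁z₃ = −(σ₁−σ₂)² τ₁τ₂ = −Δ τ₁τ₂`).  If it vanishes on a non-empty OPEN subset of `ℍ × ℍ` then, restricting to
lines `τ₂ = const` through two points and comparing two such lines, `A₁ = A₂ = dΔ = e = 0`, whence (`σ₁ ≠ σ₂`,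
`σᵢ² = lσᵢ + k`) `q = −c · (k, l, −1, 0, 0)` (§1 `exists_eq_smul_humbertNormalForm_of_isOpen`).  Consequences:
* §1 `forall_singularRelation_modularEmbedding_eq_zero_iff`, `humbertLocus_humbertNormalForm_subset_iff`: the model
  (equivalently `H_{(k,l,−1,0,0)}`) lies in `H_q` iff `q ∈ ℤ · (k,l,−1,0,0)`.
* §2 RIGIDITY (Humbert's lemma, FILE 1, moves any `H_{q₀}`, `q₀` primitive, onto a model):
  **`IsPrimitiveRel.humbertLocus_subset_iff`** `H_{q₀} ⊆ H_q ⟺ q ∈ ℤ q₀` (`Δ(q₀) > 0`);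
  **`IsPrimitiveRel.humbertLocus_eq_iff`** `H_{q₀} = H_{q₁} ⟺ q₁ = ±q₀` for primitive `q₀, q₁` — a Humbert surface
  determines its primitive relation up to sign; `IsPrimitiveRel.humbertLocus_eq_of_subset` (no proper containments).
* §3 GENERAL MEMBER: `interior_preimage_modularEmbedding_humbertLocus_eq_empty` (the trace on the model of any other
  Humbert surface is closed nowhere dense), **`dense_setOf_forall_singularRelation_modularEmbedding`** and
  `setOf_forall_singularRelation_modularEmbedding_mem_residual` (the `τ ∈ ℍ × ℍ` whose surface has relation lattice
  exactly `ℤ · (k,l,−1,0,0)` form a dense residual set — Baire on `ℍ × ℍ`),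
  `finrank_hodgeClasses_eq_two_of_forall_singularRelation` (relation lattice `ℤq₀` ⟹ `dim_ℚ H²_Hodge = 2`, row A4-59‴),
  **`dense_setOf_finrank_hodgeClasses_modularEmbedding_eq_two`** (`ρ(X_{π(τ)}) = 2` for a dense set of `τ`),
  `humbertLocus_humbertNormalForm_subset_closure`, and for EVERY component
  **`IsPrimitiveRel.humbertLocus_subset_closure`**, **`IsPrimitiveRel.humbertLocus_subset_closure_finrank_eq_two`**:
  `H_{q₀} ⊆ closure {Z ∈ H_{q₀} | ρ(X_Z) = 2}` (`q₀` primitive, `Δ(q₀) > 0`; transported along the homeomorphism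
  `Z ↦ ᵗM · Z` of `𝔥₂` given by Humbert's lemma).

What is NOT formalised here: the `End^s`-form of the equality (`End^s_ℚ(X_Z) = ℚ(√Δ)` for the general member; it
follows from the `ρ`-form through row A4-60's `NS_ℚ ≅ End^s_ℚ`, not threaded here), and Prop. 4.9 (3) (quaternion
multiplication on `H_Δ ∩ H_Δ′`).

All statements are theorems (no named facts). Imports: Literature + Mathlib only.
-/

open Matrix Complex Module Function Set
open scoped UpperHalfPlane

namespace Literature.AlgebraicGeometry.ModuliOfAbelianVarieties

namespace SiegelModuli

open Literature.NumberTheory.Automorphic (siegelUpperHalfSpace)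
open Literature.NumberTheory.ModularForms.SiegelUpperHalfSpace
open Literature.Geometry.Kaehler Literature.Geometry.Kaehler.ComplexTorus
open _root_.Topology Filter

/-! ## §1 The singular relations restricted to Runge's model `π_{k,l}(ℍ × ℍ)` -/

section Model

variable (k l : ℤ)

/-- **A singular relation restricted to Runge's model is a polynomial of degree `≤ 2` in `(τ₁, τ₂)`:
`rel_q(π_{k,l}(τ)) = A₁(q) τ₁ + A₂(q) τ₂ − d Δ τ₁τ₂ + e`, `Aᵢ(q) = a + b σᵢ + c σᵢ²`** — from Runge's
`π_{k,l}(τ) = (τ₁+τ₂, σ₁τ₁+σ₂τ₂; σ₁τ₁+σ₂τ₂, σ₁²τ₁+σ₂²τ₂)` (row A4-64 `modularEmbeddingMatrix_eq`) and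
`z₂² − z₁z₃ = −(σ₁ − σ₂)² τ₁τ₂ = −Δ τ₁τ₂`. [cite: Runge1999EndomorphismRingsAbelianSurfaces, §4 p. 290] [cite: BirkenhakeWilhelm2003, §4 eq. (8) (p. 1827)] -/
theorem singularRelation_modularEmbeddingMatrix (h : 0 ≤ quadDisc k l) (q : Fin 5 → ℂ) (τ : Fin 2 → ℂ) :
    singularRelation q (modularEmbeddingMatrix k l τ) =
      (q 0 + q 1 * (quadRoot k l 0 : ℝ) + q 2 * ((quadRoot k l 0 : ℝ) : ℂ) ^ 2) * τ 0 +
        (q 0 + q 1 * (quadRoot k l 1 : ℝ) + q 2 * ((quadRoot k l 1 : ℝ) : ℂ) ^ 2) * τ 1 -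
        q 3 * (quadDisc k l : ℂ) * (τ 0 * τ 1) + q 4 := by
  have hs := sub_quadRoot_sq_complex h
  rw [singularRelation_apply, modularEmbeddingMatrix_eq]
  simp only [of_apply, cons_val', cons_val_zero, cons_val_one, cons_val_fin_one, empty_val']
  push_cast
  linear_combination (-(q 3 * τ 0 * τ 1)) * hs

/-- **The coefficients of that polynomial vanish only for multiples of the normal form**: `A₁(q) = A₂(q) = 0` and
`d = e = 0` force `q = −c · (k, l, −1, 0, 0)` (`σ₁ ≠ σ₂` for `Δ > 0`, `σᵢ² = lσᵢ + k`).
[cite: Runge1999EndomorphismRingsAbelianSurfaces, §4 p. 290] [cite: BirkenhakeWilhelm2003, §4 Prop. 4.9 (p. 1831)] -/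
theorem eq_smul_humbertNormalForm_of_coeff_eq_zero (hΔ : 0 < quadDisc k l) {q : Fin 5 → ℤ}
    (h0 : (q 0 : ℂ) + q 1 * (quadRoot k l 0 : ℝ) + q 2 * ((quadRoot k l 0 : ℝ) : ℂ) ^ 2 = 0)
    (h1 : (q 0 : ℂ) + q 1 * (quadRoot k l 1 : ℝ) + q 2 * ((quadRoot k l 1 : ℝ) : ℂ) ^ 2 = 0)
    (h3 : q 3 = 0) (h4 : q 4 = 0) : q = (-q 2) • humbertNormalForm k l := by
  have hsq := quadRoot_sq_complex hΔ.le
  have hne : ((quadRoot k l 0 : ℝ) : ℂ) ≠ (quadRoot k l 1 : ℝ) := by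
    exact_mod_cast quadRoot_zero_ne_one hΔ
  have hB : ((q 1 : ℂ) + q 2 * l) * ((quadRoot k l 0 : ℝ) - (quadRoot k l 1 : ℝ)) = 0 := by
    linear_combination h0 - h1 - (q 2 : ℂ) * hsq 0 + (q 2 : ℂ) * hsq 1
  have hB' : (q 1 : ℂ) + q 2 * l = 0 := (mul_eq_zero.1 hB).resolve_right (sub_ne_zero.2 hne)
  have hA : (q 0 : ℂ) + q 2 * k = 0 := by
    linear_combination h0 - (q 2 : ℂ) * hsq 0 - ((quadRoot k l 0 : ℝ) : ℂ) * hB'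
  have hB'' : q 1 + q 2 * l = 0 := by exact_mod_cast hB'
  have hA'' : q 0 + q 2 * k = 0 := by exact_mod_cast hA
  funext i
  fin_cases i <;> simp [humbertNormalForm, h3, h4] <;> linarith

/-- Every open neighbourhood of a point of `ℍ` contains a second point (with a different complex coordinate).
[folklore] -/
private theorem exists_mem_coe_ne {V : Set ℍ} (hV : IsOpen V) {x : ℍ} (hx : x ∈ V) : ∃ y ∈ V, (y : ℂ) ≠ x := by
  have ho : IsOpen (((↑) : ℍ → ℂ) '' V) := UpperHalfPlane.isOpenEmbedding_coe.isOpenMap _ hV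
  obtain ⟨ε, hε, hball⟩ := Metric.isOpen_iff.1 ho (x : ℂ) ⟨x, hx, rfl⟩
  have hmem : (x : ℂ) + ((ε / 2 : ℝ) : ℂ) * Complex.I ∈ Metric.ball (x : ℂ) ε := by
    rw [Metric.mem_ball, dist_eq_norm, add_sub_cancel_left, norm_mul, Complex.norm_real, Complex.norm_I, mul_one,
      Real.norm_eq_abs, abs_of_pos (half_pos hε)]
    exact half_lt_self hε
  obtain ⟨y, hyV, hy⟩ := hball hmem
  refine ⟨y, hyV, ?_⟩
  rw [hy]
  intro h
  have him := congrArg Complex.im h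
  simp only [Complex.add_im, Complex.mul_im, Complex.ofReal_re, Complex.I_im, Complex.ofReal_im, Complex.I_re,
    mul_one, mul_zero, add_zero] at him
  linarith

/-- **THE ENGINE: an integer relation vanishing on a non-empty OPEN subset of Runge's model `π_{k,l}(ℍ × ℍ)` is a
multiple of the normal form `(k, l, −1, 0, 0)`** (the polynomial `A₁τ₁ + A₂τ₂ − dΔτ₁τ₂ + e` of
`singularRelation_modularEmbeddingMatrix` vanishes on a product of open sets only if all its coefficients vanish).
[cite: BirkenhakeWilhelm2003, §4 Prop. 4.9 (p. 1831)] [cite: Runge1999EndomorphismRingsAbelianSurfaces, §4 p. 290] -/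
theorem exists_eq_smul_humbertNormalForm_of_isOpen (hΔ : 0 < quadDisc k l) {q : Fin 5 → ℤ} {U : Set (Fin 2 → ℍ)}
    (hU : IsOpen U) (hne : U.Nonempty)
    (h : ∀ τ ∈ U, singularRelation (fun i ↦ (q i : ℂ)) (modularEmbedding k l hΔ τ : Matrix (Fin 2) (Fin 2) ℂ) = 0) :
    ∃ m : ℤ, q = m • humbertNormalForm k l := by
  obtain ⟨τ₀, hτ₀⟩ := hne
  obtain ⟨u, hu, hsub⟩ := isOpen_pi_iff'.1 hU τ₀ hτ₀
  set A := (q 0 : ℂ) + q 1 * (quadRoot k l 0 : ℝ) + q 2 * ((quadRoot k l 0 : ℝ) : ℂ) ^ 2 with hAdef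
  set B := (q 0 : ℂ) + q 1 * (quadRoot k l 1 : ℝ) + q 2 * ((quadRoot k l 1 : ℝ) : ℂ) ^ 2 with hBdef
  have key : ∀ s ∈ u 0, ∀ t ∈ u 1,
      A * (s : ℂ) + B * (t : ℂ) - q 3 * (quadDisc k l : ℂ) * ((s : ℂ) * (t : ℂ)) + q 4 = 0 := by
    intro s hs t ht
    have hmem : (![s, t] : Fin 2 → ℍ) ∈ U := hsub (Set.mem_univ_pi.2 fun i ↦ by fin_cases i <;> assumption)
    have e := h _ hmem
    have hc : (modularEmbedding k l hΔ ![s, t] : Matrix (Fin 2) (Fin 2) ℂ) =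
        modularEmbeddingMatrix k l ![(s : ℂ), (t : ℂ)] := by
      change modularEmbeddingMatrix k l _ = _
      congr 1
      funext i
      fin_cases i <;> rfl
    rw [hc, singularRelation_modularEmbeddingMatrix k l hΔ.le] at e
    simpa only [cons_val_zero, cons_val_one] using e
  obtain ⟨s', hs', hs'ne⟩ := exists_mem_coe_ne (hu 0).1 (hu 0).2
  obtain ⟨t', ht', ht'ne⟩ := exists_mem_coe_ne (hu 1).1 (hu 1).2
  have slope : ∀ t ∈ u 1, A - q 3 * (quadDisc k l : ℂ) * (t : ℂ) = 0 := fun t ht ↦ by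
    have e1 := key (τ₀ 0) (hu 0).2 t ht
    have e2 := key s' hs' t ht
    have e : (A - q 3 * (quadDisc k l : ℂ) * (t : ℂ)) * ((s' : ℂ) - (τ₀ 0 : ℂ)) = 0 := by
      linear_combination e2 - e1
    exact (mul_eq_zero.1 e).resolve_right (sub_ne_zero.2 hs'ne)
  have const : ∀ t ∈ u 1, B * (t : ℂ) + q 4 = 0 := fun t ht ↦ by
    have e1 := key (τ₀ 0) (hu 0).2 t ht
    have sl := slope t ht
    linear_combination e1 - (τ₀ 0 : ℂ) * sl
  have hD : (q 3 : ℂ) * (quadDisc k l : ℂ) = 0 := by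
    have e1 := slope (τ₀ 1) (hu 1).2
    have e2 := slope t' ht'
    have e : (q 3 : ℂ) * (quadDisc k l : ℂ) * ((t' : ℂ) - (τ₀ 1 : ℂ)) = 0 := by linear_combination e1 - e2
    exact (mul_eq_zero.1 e).resolve_right (sub_ne_zero.2 ht'ne)
  have hA : A = 0 := by
    have e1 := slope (τ₀ 1) (hu 1).2
    linear_combination e1 + (τ₀ 1 : ℂ) * hD
  have hB : B = 0 := by
    have e1 := const (τ₀ 1) (hu 1).2
    have e2 := const t' ht'
    have e : B * ((t' : ℂ) - (τ₀ 1 : ℂ)) = 0 := by linear_combination e2 - e1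
    exact (mul_eq_zero.1 e).resolve_right (sub_ne_zero.2 ht'ne)
  have hE : (q 4 : ℂ) = 0 := by
    have e1 := const (τ₀ 1) (hu 1).2
    linear_combination e1 - (τ₀ 1 : ℂ) * hB
  have hΔ0 : (quadDisc k l : ℂ) ≠ 0 := by exact_mod_cast hΔ.ne'
  have h3 : q 3 = 0 := by exact_mod_cast (mul_eq_zero.1 hD).resolve_right hΔ0
  have h4 : q 4 = 0 := by exact_mod_cast hE
  exact ⟨-q 2, eq_smul_humbertNormalForm_of_coeff_eq_zero k l hΔ hA hB h3 h4⟩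

/-- **The only integer singular relations satisfied by ALL of Runge's model `π_{k,l}(ℍ × ℍ)` are the multiples of the
normal form `(k, l, −1, 0, 0)`.** This is the algebraic heart of "for the general member of `H_Δ`, `End^s_ℚ = ℚ(√Δ)`
and `ρ = 2`" (B–W Prop. 4.9 (2)). [cite: BirkenhakeWilhelm2003, §4 Prop. 4.9 (p. 1831)] [cite: Runge1999EndomorphismRingsAbelianSurfaces, §4 p. 290] -/
theorem forall_singularRelation_modularEmbedding_eq_zero_iff (hΔ : 0 < quadDisc k l) (q : Fin 5 → ℤ) :
    (∀ τ : Fin 2 → ℍ, singularRelation (fun i ↦ (q i : ℂ))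
        (modularEmbedding k l hΔ τ : Matrix (Fin 2) (Fin 2) ℂ) = 0) ↔
      ∃ m : ℤ, q = m • humbertNormalForm k l := by
  constructor
  · intro h
    exact exists_eq_smul_humbertNormalForm_of_isOpen k l hΔ isOpen_univ ⟨fun _ ↦ UpperHalfPlane.I, Set.mem_univ _⟩
      fun τ _ ↦ h τ
  · rintro ⟨m, rfl⟩ τ
    have hc : (fun i ↦ (((m • humbertNormalForm k l) i : ℤ) : ℂ)) =
        (m : ℂ) • fun i ↦ (humbertNormalForm k l i : ℂ) := by
      funext i; simp
    rw [hc, singularRelation_smul]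
    change (m : ℂ) * singularRelation _ (modularEmbeddingMatrix k l _) = 0
    rw [singularRelation_humbertNormalForm_modularEmbeddingMatrix hΔ.le, mul_zero]

/-- **Set form: Runge's model lies inside the Humbert surface `H_q` iff `q ∈ ℤ · (k, l, −1, 0, 0)`; in particular
`H_{(k,l,−1,0,0)} ⊆ H_q ⟺ q ∈ ℤ · (k, l, −1, 0, 0)`** (row A4-64 `range_modularEmbedding`). [cite: BirkenhakeWilhelm2003, §4 Prop. 4.9 (p. 1831)] [cite: Runge1999EndomorphismRingsAbelianSurfaces, §4 pp. 290–291] -/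
theorem humbertLocus_humbertNormalForm_subset_iff (hΔ : 0 < quadDisc k l) (q : Fin 5 → ℤ) :
    humbertLocus (fun i ↦ (humbertNormalForm k l i : ℂ)) ⊆ humbertLocus (fun i ↦ (q i : ℂ)) ↔
      ∃ m : ℤ, q = m • humbertNormalForm k l := by
  rw [← range_modularEmbedding hΔ, Set.range_subset_iff, ← forall_singularRelation_modularEmbedding_eq_zero_iff k l hΔ]
  simp only [mem_humbertLocus_iff]

end Model

/-! ## §2 A Humbert surface component determines its primitive relation up to sign -/

section Rigidity

variable {q₀ : Fin 5 → ℤ}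

/-- Multiples of a relation vanish where the relation does: `H_q ⊆ H_{m q}`. [cite: BirkenhakeWilhelm2003, §4 eq. (8) (p. 1827)] -/
theorem humbertLocus_subset_humbertLocus_smul (q : Fin 5 → ℤ) (m : ℤ) :
    humbertLocus (fun i ↦ (q i : ℂ)) ⊆ humbertLocus (fun i ↦ ((m • q) i : ℂ)) := by
  intro Z hZ
  rw [mem_humbertLocus_iff] at hZ ⊢
  have hc : (fun i ↦ (((m • q) i : ℤ) : ℂ)) = (m : ℂ) • fun i ↦ (q i : ℂ) := by
    funext i; simp
  rw [hc, singularRelation_smul, hZ, mul_zero]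

/-- **RIGIDITY OF HUMBERT SURFACES: for a PRIMITIVE relation `q₀` of invariant `Δ(q₀) > 0` and any integer relation `q`,
`H_{q₀} ⊆ H_q ⟺ q ∈ ℤ q₀`** — the only relations holding on a whole Humbert surface are the multiples of its primitive
relation (Humbert's lemma, FILE 1, moves `H_{q₀}` onto Runge's model, where §1 applies). Equivalently: the general
member of `H_{q₀}` satisfies no relation independent of `q₀`. [cite: BirkenhakeWilhelm2003, §4 Prop. 4.5 and Prop. 4.9 (pp. 1828–1831)] [cite: Runge1999EndomorphismRingsAbelianSurfaces, §4 pp. 290–291] -/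
theorem IsPrimitiveRel.humbertLocus_subset_iff (hq₀ : IsPrimitiveRel q₀) (hpos : 0 < humbertInvariant q₀)
    (q : Fin 5 → ℤ) :
    humbertLocus (fun i ↦ (q₀ i : ℂ)) ⊆ humbertLocus (fun i ↦ (q i : ℂ)) ↔ ∃ m : ℤ, q = m • q₀ := by
  refine ⟨fun hsub ↦ ?_, ?_⟩
  · have hkl : quadDisc (humbertInvariant q₀ / 4) (humbertInvariant q₀ % 4) = humbertInvariant q₀ :=
      quadDisc_ediv_emod (humbertInvariant_emod_four q₀)
    have hΔ : 0 < quadDisc (humbertInvariant q₀ / 4) (humbertInvariant q₀ % 4) := by rwa [hkl]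
    obtain ⟨M, hM, hconj⟩ := hq₀.humbertEquiv_humbertNormalForm hkl
    have hsub' : humbertLocus (fun i ↦ (humbertNormalForm (humbertInvariant q₀ / 4) (humbertInvariant q₀ % 4) i : ℂ)) ⊆
        humbertLocus (fun i ↦ (humbertVectorConj M q i : ℂ)) := by
      intro Z hZ
      rw [← hconj, mem_humbertLocus_humbertVectorConj_iff hM] at hZ
      rw [mem_humbertLocus_humbertVectorConj_iff hM]
      exact hsub hZ
    obtain ⟨m, hm⟩ := (humbertLocus_humbertNormalForm_subset_iff _ _ hΔ _).1 hsub'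
    refine ⟨m, ?_⟩
    have e := congrArg (humbertVectorConj (spInv M)) hm
    rwa [humbertVectorConj_spInv_humbertVectorConj hM, ← hconj, ← humbertVectorConj_smul,
      humbertVectorConj_spInv_humbertVectorConj hM] at e
  · rintro ⟨m, rfl⟩
    exact humbertLocus_subset_humbertLocus_smul q₀ m

/-- **Two primitive relations with positive invariant cut out the same Humbert surface iff they agree up to sign:
`H_{q₀} = H_{q₁} ⟺ q₁ = ±q₀`.** [cite: BirkenhakeWilhelm2003, §4 Prop. 4.5 and Prop. 4.9 (pp. 1828–1831)] -/
theorem IsPrimitiveRel.humbertLocus_eq_iff (hq₀ : IsPrimitiveRel q₀) (hpos : 0 < humbertInvariant q₀) {q₁ : Fin 5 → ℤ}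
    (hq₁ : IsPrimitiveRel q₁) :
    humbertLocus (fun i ↦ (q₀ i : ℂ)) = humbertLocus (fun i ↦ (q₁ i : ℂ)) ↔ q₁ = q₀ ∨ q₁ = -q₀ := by
  constructor
  · intro h
    obtain ⟨m, hm⟩ := (hq₀.humbertLocus_subset_iff hpos q₁).1 h.le
    rcases hq₁ m q₀ hm with rfl | rfl
    · exact Or.inl (by rw [hm, one_smul])
    · exact Or.inr (by rw [hm, neg_one_smul])
  · rintro (rfl | rfl)
    · rfl
    · refine Set.Subset.antisymm ?_ ?_
      · simpa only [neg_one_smul] using humbertLocus_subset_humbertLocus_smul q₀ (-1)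
      · have := humbertLocus_subset_humbertLocus_smul (-q₀) (-1)
        simpa only [neg_one_smul, neg_neg] using this

/-- **A proper containment `H_{q₀} ⊊ H_q` never happens between Humbert surfaces: `H_{q₀} ⊆ H_q` with `q ≠ 0` forces
`H_q = H_{q₀}`** (`q = m q₀`, `m ≠ 0`, and `H_{m q₀} = H_{q₀}`). [cite: BirkenhakeWilhelm2003, §4 Prop. 4.9 (p. 1831)] -/
theorem IsPrimitiveRel.humbertLocus_eq_of_subset (hq₀ : IsPrimitiveRel q₀) (hpos : 0 < humbertInvariant q₀)
    {q : Fin 5 → ℤ} (hq : q ≠ 0) (hsub : humbertLocus (fun i ↦ (q₀ i : ℂ)) ⊆ humbertLocus (fun i ↦ (q i : ℂ))) :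
    humbertLocus (fun i ↦ (q i : ℂ)) = humbertLocus (fun i ↦ (q₀ i : ℂ)) := by
  obtain ⟨m, rfl⟩ := (hq₀.humbertLocus_subset_iff hpos q).1 hsub
  have hm : m ≠ 0 := by rintro rfl; exact hq (zero_smul ℤ q₀)
  refine Set.Subset.antisymm (fun Z hZ ↦ ?_) hsub
  rw [mem_humbertLocus_iff] at hZ ⊢
  have hc : (fun i ↦ (((m • q₀) i : ℤ) : ℂ)) = (m : ℂ) • fun i ↦ (q₀ i : ℂ) := by
    funext i; simp
  rw [hc, singularRelation_smul] at hZ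
  exact (mul_eq_zero.1 hZ).resolve_left (by exact_mod_cast hm)

end Rigidity

/-! ## §3 The general member of a Humbert surface has Picard number exactly `2` (B–W Prop. 4.9 (2)) -/

section General

variable (k l : ℤ)

/-- The trace `π⁻¹(H_q)` of a Humbert surface on Runge's model is closed. [cite: BirkenhakeWilhelm2003, §1 (∗) (p. 1819)] -/
theorem isClosed_preimage_modularEmbedding_humbertLocus (hΔ : 0 < quadDisc k l) (q : Fin 5 → ℂ) :
    IsClosed (modularEmbedding k l hΔ ⁻¹' humbertLocus q) :=
  (isClosed_humbertLocus q).preimage (continuous_modularEmbedding hΔ)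

/-- **The trace `π_{k,l}⁻¹(H_q)` on Runge's model of a Humbert surface `H_q` with `q ∉ ℤ · (k, l, −1, 0, 0)` has empty
interior in `ℍ × ℍ`** — "the intersection of two different Humbert surfaces is a curve" at the level needed for
"general member". [cite: BirkenhakeWilhelm2003, §4 Prop. 4.9 (p. 1831)] -/
theorem interior_preimage_modularEmbedding_humbertLocus_eq_empty (hΔ : 0 < quadDisc k l) {q : Fin 5 → ℤ}
    (hq : ¬ ∃ m : ℤ, q = m • humbertNormalForm k l) :
    interior (modularEmbedding k l hΔ ⁻¹' humbertLocus (fun i ↦ (q i : ℂ))) = ∅ := by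
  rw [Set.eq_empty_iff_forall_notMem]
  intro τ hτ
  refine hq (exists_eq_smul_humbertNormalForm_of_isOpen k l hΔ isOpen_interior ⟨τ, hτ⟩ fun τ' hτ' ↦ ?_)
  have h' : τ' ∈ modularEmbedding k l hΔ ⁻¹' humbertLocus (fun i ↦ (q i : ℂ)) := interior_subset hτ'
  exact mem_humbertLocus_iff.1 h'

/-- **B–W Prop. 4.9 (2), "FOR THE GENERAL MEMBER … EQUALITY HOLDS", on Runge's model: the parameters `τ ∈ ℍ × ℍ`
whose surface `X_{π(τ)}` satisfies NO integer singular relation other than the multiples of `(k, l, −1, 0, 0)` form a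
DENSE subset of `ℍ × ℍ`** (a countable intersection of open dense sets in the Baire space `ℍ × ℍ`).
[cite: BirkenhakeWilhelm2003, §4 Prop. 4.9 (p. 1831)] -/
theorem dense_setOf_forall_singularRelation_modularEmbedding (hΔ : 0 < quadDisc k l) :
    Dense {τ : Fin 2 → ℍ | ∀ q : Fin 5 → ℤ, singularRelation (fun i ↦ (q i : ℂ))
      (modularEmbedding k l hΔ τ : Matrix (Fin 2) (Fin 2) ℂ) = 0 → ∃ m : ℤ, q = m • humbertNormalForm k l} := by
  have hset : {τ : Fin 2 → ℍ | ∀ q : Fin 5 → ℤ, singularRelation (fun i ↦ (q i : ℂ))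
      (modularEmbedding k l hΔ τ : Matrix (Fin 2) (Fin 2) ℂ) = 0 → ∃ m : ℤ, q = m • humbertNormalForm k l} =
      ⋂ q : Fin 5 → ℤ, {τ | singularRelation (fun i ↦ (q i : ℂ))
        (modularEmbedding k l hΔ τ : Matrix (Fin 2) (Fin 2) ℂ) = 0 → ∃ m : ℤ, q = m • humbertNormalForm k l} := by
    ext τ; simp only [Set.mem_iInter, Set.mem_setOf_eq]
  rw [hset]
  have hrepr : ∀ q : Fin 5 → ℤ, {τ : Fin 2 → ℍ | singularRelation (fun i ↦ (q i : ℂ))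
      (modularEmbedding k l hΔ τ : Matrix (Fin 2) (Fin 2) ℂ) = 0 → ∃ m : ℤ, q = m • humbertNormalForm k l} =
      (modularEmbedding k l hΔ ⁻¹' humbertLocus (fun i ↦ (q i : ℂ)))ᶜ ∪
        {_τ | ∃ m : ℤ, q = m • humbertNormalForm k l} := by
    intro q; ext τ
    simp only [Set.mem_setOf_eq, Set.mem_union, Set.mem_compl_iff, Set.mem_preimage, mem_humbertLocus_iff]
    exact imp_iff_not_or
  refine dense_iInter_of_isOpen (fun q ↦ ?_) (fun q ↦ ?_)
  · rw [hrepr]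
    exact (isClosed_preimage_modularEmbedding_humbertLocus k l hΔ _).isOpen_compl.union isOpen_const
  · rw [hrepr]
    by_cases hq : ∃ m : ℤ, q = m • humbertNormalForm k l
    · have huniv : {_τ : Fin 2 → ℍ | ∃ m : ℤ, q = m • humbertNormalForm k l} = Set.univ :=
        Set.eq_univ_of_forall fun _ ↦ hq
      rw [huniv, Set.union_univ]
      exact dense_univ
    · have hemp : {_τ : Fin 2 → ℍ | ∃ m : ℤ, q = m • humbertNormalForm k l} = ∅ :=
        Set.eq_empty_of_forall_notMem fun _ h ↦ hq h
      rw [hemp, Set.union_empty, ← interior_eq_empty_iff_dense_compl]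
      exact interior_preimage_modularEmbedding_humbertLocus_eq_empty k l hΔ hq

/-- The same set is residual (comeagre) in `ℍ × ℍ`. [cite: BirkenhakeWilhelm2003, §4 Prop. 4.9 (p. 1831)] -/
theorem setOf_forall_singularRelation_modularEmbedding_mem_residual (hΔ : 0 < quadDisc k l) :
    {τ : Fin 2 → ℍ | ∀ q : Fin 5 → ℤ, singularRelation (fun i ↦ (q i : ℂ))
      (modularEmbedding k l hΔ τ : Matrix (Fin 2) (Fin 2) ℂ) = 0 → ∃ m : ℤ, q = m • humbertNormalForm k l} ∈
      residual (Fin 2 → ℍ) := by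
  have hset : {τ : Fin 2 → ℍ | ∀ q : Fin 5 → ℤ, singularRelation (fun i ↦ (q i : ℂ))
      (modularEmbedding k l hΔ τ : Matrix (Fin 2) (Fin 2) ℂ) = 0 → ∃ m : ℤ, q = m • humbertNormalForm k l} =
      ⋂ q : Fin 5 → ℤ, {τ | singularRelation (fun i ↦ (q i : ℂ))
        (modularEmbedding k l hΔ τ : Matrix (Fin 2) (Fin 2) ℂ) = 0 → ∃ m : ℤ, q = m • humbertNormalForm k l} := by
    ext τ; simp only [Set.mem_iInter, Set.mem_setOf_eq]
  rw [hset, countable_iInter_mem]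
  intro q
  have hrepr : {τ : Fin 2 → ℍ | singularRelation (fun i ↦ (q i : ℂ))
      (modularEmbedding k l hΔ τ : Matrix (Fin 2) (Fin 2) ℂ) = 0 → ∃ m : ℤ, q = m • humbertNormalForm k l} =
      (modularEmbedding k l hΔ ⁻¹' humbertLocus (fun i ↦ (q i : ℂ)))ᶜ ∪
        {_τ | ∃ m : ℤ, q = m • humbertNormalForm k l} := by
    ext τ
    simp only [Set.mem_setOf_eq, Set.mem_union, Set.mem_compl_iff, Set.mem_preimage, mem_humbertLocus_iff]
    exact imp_iff_not_or
  rw [hrepr]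
  by_cases hq : ∃ m : ℤ, q = m • humbertNormalForm k l
  · have huniv : {_τ : Fin 2 → ℍ | ∃ m : ℤ, q = m • humbertNormalForm k l} = Set.univ :=
      Set.eq_univ_of_forall fun _ ↦ hq
    rw [huniv, Set.union_univ]
    exact univ_mem
  · have hemp : {_τ : Fin 2 → ℍ | ∃ m : ℤ, q = m • humbertNormalForm k l} = ∅ :=
      Set.eq_empty_of_forall_notMem fun _ h ↦ hq h
    rw [hemp, Set.union_empty]
    refine residual_of_dense_open (isClosed_preimage_modularEmbedding_humbertLocus k l hΔ _).isOpen_compl ?_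
    rw [← interior_eq_empty_iff_dense_compl]
    exact interior_preimage_modularEmbedding_humbertLocus_eq_empty k l hΔ hq

/-- Clearing denominators in `ℚ⁵`. [folklore] -/
private theorem exists_nat_mul_eq_intCast (q : Fin 5 → ℚ) :
    ∃ N : ℕ, 0 < N ∧ ∃ q' : Fin 5 → ℤ, ∀ i, (N : ℚ) * q i = q' i := by
  refine ⟨∏ j, (q j).den, Finset.prod_pos fun j _ ↦ (q j).den_pos,
    fun i ↦ (((∏ j, (q j).den) / (q i).den : ℕ) : ℤ) * (q i).num, fun i ↦ ?_⟩
  dsimp only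
  obtain ⟨c, hc⟩ : (q i).den ∣ ∏ j, (q j).den := Finset.dvd_prod_of_mem _ (Finset.mem_univ i)
  rw [hc, Nat.mul_div_cancel_left c (q i).den_pos]
  push_cast
  rw [mul_comm ((q i).den : ℚ) (c : ℚ), mul_assoc, mul_comm ((q i).den : ℚ) (q i), Rat.mul_den_eq_num]

/-- **Picard number `2` from the relation lattice: if `Z ∈ H_{q₀}`, `q₀ ≠ 0`, satisfies no integer singular relation
outside `ℤ q₀`, then `dim_ℚ H²_Hodge(X_Z) = 2`, i.e. `H²_Hodge(X_Z) = ℚ θ_Z ⊕ ℚ γ_{q₀}` and `ρ(X_Z) = 2`** (row A4-59‴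
`finrank_hodgeClasses_one_eq_finrank_add_one` with the line `W = ℚ q₀` of rational relations). [cite: BirkenhakeWilhelm2003, §4 Prop. 4.9 (p. 1831)] -/
theorem finrank_hodgeClasses_eq_two_of_forall_singularRelation {Z : siegelUpperHalfSpace 2} {q₀ : Fin 5 → ℤ}
    (hq₀ : q₀ ≠ 0) (hZ : Z ∈ humbertLocus (fun i ↦ (q₀ i : ℂ)))
    (h : ∀ q : Fin 5 → ℤ, singularRelation (fun i ↦ (q i : ℂ)) (Z : Matrix (Fin 2) (Fin 2) ℂ) = 0 →
      ∃ m : ℤ, q = m • q₀) :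
    Module.finrank ℚ (hodgeClasses (prinPeriod Z : (Fin 2 ⊕ Fin 2 → ℝ) ≃L[ℝ] (Fin 2 → ℂ)) 1) = 2 := by
  set v : Fin 5 → ℚ := fun i ↦ (q₀ i : ℚ) with hv_def
  have hv : v ≠ 0 := fun h0 ↦ hq₀ (funext fun i ↦ by
    have hi := congrFun h0 i
    simp only [hv_def, Pi.zero_apply, Int.cast_eq_zero] at hi
    exact hi)
  have hZ0 := mem_humbertLocus_iff.1 hZ
  have hW : ∀ q : Fin 5 → ℚ, q ∈ ℚ ∙ v ↔
      singularRelation (fun i ↦ ((q i : ℚ) : ℂ)) (Z : Matrix (Fin 2) (Fin 2) ℂ) = 0 := by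
    intro q
    constructor
    · intro hq
      obtain ⟨c, rfl⟩ := Submodule.mem_span_singleton.1 hq
      have hc : (fun i ↦ (((c • v) i : ℚ) : ℂ)) = (c : ℂ) • fun i ↦ (q₀ i : ℂ) := by
        funext i; simp [hv_def]
      rw [hc, singularRelation_smul, hZ0, mul_zero]
    · intro hrel
      obtain ⟨N, hN, q', hq'⟩ := exists_nat_mul_eq_intCast q
      have hc : (fun i ↦ (q' i : ℂ)) = (N : ℂ) • fun i ↦ ((q i : ℚ) : ℂ) := by
        funext i
        simp only [Pi.smul_apply, smul_eq_mul]
        have e := congrArg (fun x : ℚ ↦ (x : ℂ)) (hq' i)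
        push_cast at e ⊢
        exact e.symm
      have hrel' : singularRelation (fun i ↦ (q' i : ℂ)) (Z : Matrix (Fin 2) (Fin 2) ℂ) = 0 := by
        rw [hc, singularRelation_smul, hrel, mul_zero]
      obtain ⟨m, hm⟩ := h q' hrel'
      rw [Submodule.mem_span_singleton]
      refine ⟨(m : ℚ) / N, funext fun i ↦ ?_⟩
      have e1 := hq' i
      have e2 := congrFun hm i
      simp only [Pi.smul_apply, smul_eq_mul] at e2 ⊢
      have hN' : (N : ℚ) ≠ 0 := by exact_mod_cast hN.ne'
      rw [hv_def]
      field_simp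
      rw [mul_comm, e1, e2]
      push_cast
      ring
  rw [finrank_hodgeClasses_one_eq_finrank_add_one Z (ℚ ∙ v) hW, finrank_span_singleton hv]

/-- **B–W Prop. 4.9 (2) on Runge's model, with the Picard number: for a DENSE set of `τ ∈ ℍ × ℍ` the surface
`X_{π_{k,l}(τ)}` has `dim_ℚ H²_Hodge = 2` exactly (`ρ = 2`, `H²_Hodge = ℚθ ⊕ ℚγ`)** — the first inequality
`ρ ≥ 2 = 1 + 1` of Prop. 4.9 (2) (row A4-59‴) is an equality for the general member. [cite: BirkenhakeWilhelm2003, §4 Prop. 4.9 (p. 1831)] -/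
theorem dense_setOf_finrank_hodgeClasses_modularEmbedding_eq_two (hΔ : 0 < quadDisc k l) :
    Dense {τ : Fin 2 → ℍ | Module.finrank ℚ
      (hodgeClasses (prinPeriod (modularEmbedding k l hΔ τ) : (Fin 2 ⊕ Fin 2 → ℝ) ≃L[ℝ] (Fin 2 → ℂ)) 1) = 2} := by
  refine (dense_setOf_forall_singularRelation_modularEmbedding k l hΔ).mono fun τ hτ ↦ ?_
  exact finrank_hodgeClasses_eq_two_of_forall_singularRelation (humbertNormalForm_ne_zero k l)
    (modularEmbedding_mem_humbertLocus hΔ τ) hτ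

/-- **Ambient form on `𝔥₂`: the Humbert surface `H_{(k,l,−1,0,0)} = π_{k,l}(ℍ × ℍ)` lies in the closure of its members
with NO relation outside `ℤ · (k, l, −1, 0, 0)`.** [cite: BirkenhakeWilhelm2003, §4 Prop. 4.9 (p. 1831)] -/
theorem humbertLocus_humbertNormalForm_subset_closure (hΔ : 0 < quadDisc k l) :
    humbertLocus (fun i ↦ (humbertNormalForm k l i : ℂ)) ⊆
      closure {Z | Z ∈ humbertLocus (fun i ↦ (humbertNormalForm k l i : ℂ)) ∧
        ∀ q : Fin 5 → ℤ, singularRelation (fun i ↦ (q i : ℂ)) (Z : Matrix (Fin 2) (Fin 2) ℂ) = 0 →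
          ∃ m : ℤ, q = m • humbertNormalForm k l} := by
  have hG := dense_setOf_forall_singularRelation_modularEmbedding k l hΔ
  rw [← range_modularEmbedding hΔ]
  rintro _ ⟨τ, rfl⟩
  have h1 : modularEmbedding k l hΔ τ ∈ modularEmbedding k l hΔ '' closure {τ : Fin 2 → ℍ | ∀ q : Fin 5 → ℤ,
      singularRelation (fun i ↦ (q i : ℂ)) (modularEmbedding k l hΔ τ : Matrix (Fin 2) (Fin 2) ℂ) = 0 →
        ∃ m : ℤ, q = m • humbertNormalForm k l} :=
    ⟨τ, by rw [hG.closure_eq]; exact Set.mem_univ τ, rfl⟩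
  refine closure_mono ?_ (image_closure_subset_closure_image (continuous_modularEmbedding hΔ) h1)
  rintro _ ⟨τ', hτ', rfl⟩
  exact ⟨⟨τ', rfl⟩, hτ'⟩

variable {k l}
variable {q₀ : Fin 5 → ℤ}

/-- **B–W Prop. 4.9 (2) "FOR THE GENERAL MEMBER OF `H_Δ` EQUALITY HOLDS" — for every component: a Humbert surface
`H_{q₀}` (`q₀` primitive, `Δ(q₀) > 0`) lies in the closure of its members satisfying no relation outside `ℤ q₀`**
(Humbert's lemma, FILE 1, transports the model statement along `H_{q₀} = ᵗM · H_{(k,l,−1,0,0)}`, a homeomorphism of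
`𝔥₂`). [cite: BirkenhakeWilhelm2003, §4 Prop. 4.5 and Prop. 4.9 (pp. 1828–1831)] -/
theorem IsPrimitiveRel.humbertLocus_subset_closure (hq₀ : IsPrimitiveRel q₀) (hpos : 0 < humbertInvariant q₀) :
    humbertLocus (fun i ↦ (q₀ i : ℂ)) ⊆
      closure {Z | Z ∈ humbertLocus (fun i ↦ (q₀ i : ℂ)) ∧
        ∀ q : Fin 5 → ℤ, singularRelation (fun i ↦ (q i : ℂ)) (Z : Matrix (Fin 2) (Fin 2) ℂ) = 0 →
          ∃ m : ℤ, q = m • q₀} := by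
  have hkl : quadDisc (humbertInvariant q₀ / 4) (humbertInvariant q₀ % 4) = humbertInvariant q₀ :=
    quadDisc_ediv_emod (humbertInvariant_emod_four q₀)
  have hΔ : 0 < quadDisc (humbertInvariant q₀ / 4) (humbertInvariant q₀ % 4) := by rwa [hkl]
  obtain ⟨M, hM, hconj, hloc⟩ := (hq₀.humbertEquiv_humbertNormalForm hkl).symm.exists_humbertLocus_eq_image
  set P : Matrix.symplecticGroup (Fin 2) ℝ := ⟨toGD (fun _ : Fin 2 ↦ 1) M, toGD_mem principalType_pos hM⟩ with hP
  set NF := humbertNormalForm (humbertInvariant q₀ / 4) (humbertInvariant q₀ % 4) with hNF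
  -- the good set of the model is moved into the good set of `H_{q₀}`
  have hgood : (fun Z ↦ P • Z) '' {Z | Z ∈ humbertLocus (fun i ↦ (NF i : ℂ)) ∧
      ∀ q : Fin 5 → ℤ, singularRelation (fun i ↦ (q i : ℂ)) (Z : Matrix (Fin 2) (Fin 2) ℂ) = 0 →
        ∃ m : ℤ, q = m • NF} ⊆
      {Z | Z ∈ humbertLocus (fun i ↦ (q₀ i : ℂ)) ∧
        ∀ q : Fin 5 → ℤ, singularRelation (fun i ↦ (q i : ℂ)) (Z : Matrix (Fin 2) (Fin 2) ℂ) = 0 →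
          ∃ m : ℤ, q = m • q₀} := by
    rintro _ ⟨Z, ⟨hZ, hZg⟩, rfl⟩
    refine ⟨?_, fun q hq ↦ ?_⟩
    · rw [hloc]; exact ⟨Z, hZ, rfl⟩
    · -- `P • Z ∈ H_q = H_{(q^{M⁻¹})^M}` iff `Z ∈ H_{q^{M⁻¹}}`
      have hq' : Z ∈ humbertLocus (fun i ↦ (humbertVectorConj (spInv M) q i : ℂ)) := by
        have e := (mem_humbertLocus_humbertVectorConj_iff hM (humbertVectorConj (spInv M) q) (P • Z)).1
          (by rw [humbertVectorConj_humbertVectorConj_spInv hM]; exact mem_humbertLocus_iff.2 hq)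
        rwa [inv_smul_smul] at e
      obtain ⟨m, hm⟩ := hZg _ (mem_humbertLocus_iff.1 hq')
      refine ⟨m, ?_⟩
      have e := congrArg (humbertVectorConj M) hm
      rwa [humbertVectorConj_humbertVectorConj_spInv hM, humbertVectorConj_smul, hconj] at e
  set S := {Z | Z ∈ humbertLocus (fun i ↦ (NF i : ℂ)) ∧
      ∀ q : Fin 5 → ℤ, singularRelation (fun i ↦ (q i : ℂ)) (Z : Matrix (Fin 2) (Fin 2) ℂ) = 0 →
        ∃ m : ℤ, q = m • NF} with hS
  have hmodel : humbertLocus (fun i ↦ (NF i : ℂ)) ⊆ closure S := humbertLocus_humbertNormalForm_subset_closure _ _ hΔ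
  have himg : (fun Z ↦ P • Z) '' closure S = closure ((fun Z ↦ P • Z) '' S) := (Homeomorph.smul P).image_closure S
  calc humbertLocus (fun i ↦ (q₀ i : ℂ)) = (fun Z ↦ P • Z) '' humbertLocus (fun i ↦ (NF i : ℂ)) := hloc
    _ ⊆ (fun Z ↦ P • Z) '' closure S := Set.image_mono hmodel
    _ = closure ((fun Z ↦ P • Z) '' S) := himg
    _ ⊆ _ := closure_mono hgood

/-- **B–W Prop. 4.9 (2) with the Picard number, every component: `H_{q₀} ⊆ closure {Z ∈ H_{q₀} | ρ(X_Z) = 2}` for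
`q₀` primitive with `Δ(q₀) > 0`** — the general principally polarised abelian surface with a singular relation of
invariant `Δ` has `H²_Hodge = ℚθ ⊕ ℚγ_{q₀}`, `NS`-rank `2` (and hence, by Prop. 4.9 (2)'s first clause,
`End^s_ℚ = ℚ(√Δ)` of dimension `2`). [cite: BirkenhakeWilhelm2003, §4 Prop. 4.9 (p. 1831)] -/
theorem IsPrimitiveRel.humbertLocus_subset_closure_finrank_eq_two (hq₀ : IsPrimitiveRel q₀)
    (hpos : 0 < humbertInvariant q₀) :
    humbertLocus (fun i ↦ (q₀ i : ℂ)) ⊆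
      closure {Z | Z ∈ humbertLocus (fun i ↦ (q₀ i : ℂ)) ∧
        Module.finrank ℚ (hodgeClasses (prinPeriod Z : (Fin 2 ⊕ Fin 2 → ℝ) ≃L[ℝ] (Fin 2 → ℂ)) 1) = 2} := by
  refine (hq₀.humbertLocus_subset_closure hpos).trans (closure_mono ?_)
  rintro Z ⟨hZ, hZg⟩
  exact ⟨hZ, finrank_hodgeClasses_eq_two_of_forall_singularRelation hq₀.ne_zero hZ hZg⟩

end General

end SiegelModuli

end Literature.AlgebraicGeometry.ModuliOfAbelianVarieties
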